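import Summits.QuantumFields.YangMills.Theorems.BalabanUVNodesN20BlockCaricatureClosedForm
import Summits.QuantumFields.YangMills.Theorems.BalabanUVNodesN19AgeScaleTransportBudget

/-!
# BalabanUVNodes ∕ N20·N19′·N21 — A SHARP THRESHOLD ON THE CARICATURE (FILE L of the caricature series): `n_K = m^K` independent level-1 blocks, run A's per-block large-field
# probability a sub-exponential `a_K ∈ (0,½]` (Bałaban's poly-log activity `exp(−(A·log(x₀+bK))^{2p₀})` is such), run B's `a_K(1 + ρθ^K)` — a RELATIVE two-run discrepancy contracting
# at rate `θ` per step; then stub 2's dials exist on the caricature ⟺ `m·θ² < 1` (for `m·θ² ≠ 1`): the contraction must beat the inverse SQUARE ROOT of the block-number growth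

Cell `pub-ymgap` (HUMAN RULING D-0062 Track A; work-bound push D-0149, director-ym №197), width seat `pub-ymgap-dag-n20-w1` (gen 6) on node N20 = NE7b; key item K3⁸
`SpineGivenEndpointR13SepCoPHV` = stmt-QuantumFields-27366 (dag-lead KEY MAP v2, INBOX l.35754: `--kind proof --supports 27366 --as helper`; lineage key K3⁷ stmt-QuantumFields-20544, whose
skeleton v5 941dddb108cbaacf and evidence stay as the aside — MY FILES A–J were keyed there and are lineage BY NAME); COUNT-NEUTRAL.  Bus: CLAIM-16 ∕ INTENT-21 (INBOX l.35787).
THEOREMS ONLY: no `def`, no `instance`, no `notation`, no `sorry`; imports MY FILE K `…N20BlockCaricatureClosedForm` (the closed-form criterion) and dag-n19-w1 g3's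
`…N19AgeScaleTransportBudget` (p603780: `eventually_lt_balabanActivity`, the card's NotGeometric) BY NAME.

WHY.  FILE K closed CRIT-1's `Λ∕√Λ` squeeze: on the caricature stub 2's dials exist ⟺ `Σ_K min(1, Δ_K∕max(1,σ_K)) < ∞`, which in the BULK (first-level SATURATION — MY policy wall
p597932 and toy p605682: `n_K p_K → ∞`) demands the two runs' per-block large-field probabilities agree to RELATIVE precision `o((n_K p̄_K)^{−1∕2})`, summably.  This file makes
that demand a SHARP NUMBER on the simplest two-run model the cards suggest (`age-scale-convolution` K1∕K2: the block-law discrepancy is driven by a per-step contraction; its «why it might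
fail»: «if a first-order piece survives … K1 dies in first-order currency (`a = L > 1`)»): with `m` new blocks per step and relative discrepancy `ρθ^K`, the dials exist iff `θ < m^{−1∕2}`.
Read with `m = L⁴` (blocks per RG step in `d = 4`): a contraction `θ = L^{−1}` (first order) or even `L^{−2}` (second order, the borderline) does NOT suffice on the caricature; `θ < L^{−2}`
does.  Nothing here says which `θ` — if any — Bałaban's two runs realise; that is the (YG)∕(V-b) letter, UNPRINTED for `d = 4`.
* §0 [folklore] `not_summable_of_eventually_eq_one`.
* §1 [folklore] `toy_rates` · `toy_maxVar` (`a_K∕2 ≤ max-variance ≤ 2a_K`) · ★ `toyTerm_le` (closed-form term `≤ √2·ρ·(√m·θ)^K`) · ★ `le_toyTerm` (once `σ_K ≥ 1`: `min(1, (ρ∕2)√(a_K(mθ²)^K)) ≤` term).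
* §2 [folklore ∕ bookkeeping] ★★★ `exists_hybridNE7_toy_of_contraction` (`mθ² < 1` ⇒ dials, geometric domination) · ★★★ `not_exists_hybridNE7_toy_of_expansion` (`1 < mθ²` + sub-exponential
  activity ⇒ NO dials: the term is eventually `1`) · ★★★★ `exists_hybridNE7_toy_iff` (`mθ² ≠ 1`: dials ⟺ `mθ² < 1`).
* §3 [folklore] `tendsto_pow_mul_balabanActivity` (`s^K·a_K → ∞`, every `s > 1`; n19-w1 BY NAME) · `balabanActivity_mem` (`a_K ∈ (0,½]` once `log 2 ≤ (A log x₀)^{2p₀}`) ·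
  ★★★★ `exists_hybridNE7_balabanActivity_iff` (the threshold for Bałaban's activity law verbatim) · `toy_hypotheses_inhabited` (A6).
* §4 [folklore] ★★ `bulkTerm_relPrecision` (comparable rates `p ≤ q ≤ 2p ≤ 1`, `σ ≥ 1`: the closed-form term is `min(1, √(np)·(q∕p − 1))` within `√2` — the general reading behind the toy).
* §5 [folklore ∕ bookkeeping] ★★★ `exists_hybridNE7_caricature_iff_summable_relPrecision_of_bulk` (rates `p_K ∈ (0,½]`, `q_K = p_K(1+ε_K)`, `ε_K ∈ [0,1]`, bulk ∀K:
  dials ⟺ `Σ_K min(1, √(n_K p_K)·ε_K) < ∞` — relative precision `o((n_K p_K)^{−1∕2})`, summably; the toy of §2 is `n_K = m^K`, `ε_K = ρθ^K`).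

HONEST FRAMING.  [folklore] real analysis ∕ [bookkeeping] on a CARICATURE (independent level-1 blocks, product Bernoulli class weights — the card's simplification) with a MODEL two-run
discrepancy `q_K = p_K(1 + ρθ^K)` chosen by this seat (A6: all hypotheses jointly inhabited — e.g. `m = 4`, `θ = ⅓` ∕ `θ = ¾`, `ρ = 1`, `A = b = 1`, `x₀ = 3`, `p₀ = 1`); NOTHING read
at the record; which contraction rate — if any — the record's two runs have is UNDECIDED and is exactly the unprinted two-run letter ((YG)∕(V-b)); proves NO estimate of Bałaban's; refutes
NO registered stub (the caricature is not the stub); nothing of Bałaban's asserted or instantiated.  NE7 ∕ NE7b ∕ NE7c NOT PRINTED for `d = 4`, NOT proved; N19 ∕ N20 ∕ N21 NOT discharged;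
K3⁸ (stmt-QuantumFields-27366, skeleton v6 b4e55110ab73e679) and its aside K3⁷ OPEN, no stub claimed; counts unmoved (typed 28∕28 · discharged 5∕27); no count claim.  One finite `𝕋⁴` programme at fixed `ε`, Bałaban AS PRINTED; the YM mass gap
(Clay) is NOT proved by any of this — R4 closes the conditional finite-𝕋⁴ rung `BalabanLadder.UV` only; NOT ℝ⁴, NOT OS.  Source for the activity law (bookkeeping only):
[Balaban1988Convergent] (1.1) p.244.  No decl carries a cite tag.
-/

set_option autoImplicit false

noncomputable section

open Finset Filter Topology
open Literature.MathematicalPhysics.QuantumFieldTheory.Balaban1983to89.T4MatchingAssembly (HybridNE7)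
open Summit.QuantumFields.YangMills.BalabanUVNodes.N20BlockCaricatureClosedForm
open Summit.QuantumFields.YangMills.BalabanUVNodes.N19AgeScaleTransportBudget (eventually_lt_balabanActivity)

namespace Summit.QuantumFields.YangMills.BalabanUVNodes.N20BlockCaricatureDiscrepancyToy

/-! ## §0 A real-analysis helper [folklore] -/

/-- A sequence of reals in `[0,1]` that is eventually `= 1` is not summable. [folklore] -/
theorem not_summable_of_eventually_eq_one {t : ℕ → ℝ} (h : ∀ᶠ K in atTop, t K = 1) : ¬ Summable t := by
  intro hs
  have h0 := hs.tendsto_atTop_zero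
  have h1 : Tendsto t atTop (𝓝 1) := tendsto_const_nhds.congr' (h.mono fun K hK => hK.symm)
  exact zero_ne_one (tendsto_nhds_unique h0 h1)

/-! ## §1 The toy: `n_K = m^K` blocks, rates `p_K = a_K`, `q_K = a_K(1 + ρθ^K)`; the closed-form term against `(√m·θ)^K` [folklore] -/

section Toy
variable {a : ℕ → ℝ} {m : ℕ} {ρ θ : ℝ}
/-- Rates of the toy are in range: `0 < a_K ≤ ½`, `0 < ρ ≤ 1`, `0 < θ < 1` ⇒ `p_K = a_K ∈ (0,1)`, `q_K = a_K(1+ρθ^K) ∈ [0,1]`, and `q_K − p_K = a_K ρ θ^K`. [folklore] -/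
theorem toy_rates (ha : ∀ K, 0 < a K ∧ a K ≤ 1 / 2) (hρ0 : 0 < ρ) (hρ1 : ρ ≤ 1) (hθ0 : 0 < θ) (hθ1 : θ < 1) (K : ℕ) :
    (0 < a K ∧ a K < 1) ∧ (0 ≤ a K * (1 + ρ * θ ^ K) ∧ a K * (1 + ρ * θ ^ K) ≤ 1) ∧ a K * (1 + ρ * θ ^ K) - a K = a K * ρ * θ ^ K := by
  obtain ⟨h0, h1⟩ := ha K
  have hθK : θ ^ K ≤ 1 := pow_le_one₀ hθ0.le hθ1.le
  have hθK0 : 0 ≤ θ ^ K := pow_nonneg hθ0.le K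
  refine ⟨⟨h0, by linarith⟩, ⟨by positivity, ?_⟩, by ring⟩
  nlinarith [mul_le_mul hρ1 hθK hθK0 zero_le_one]

/-- The larger per-block variance of the toy is comparable to `a_K`: `a_K∕2 ≤ max(p(1−p), q(1−q)) ≤ 2a_K`. [folklore] -/
theorem toy_maxVar (ha : ∀ K, 0 < a K ∧ a K ≤ 1 / 2) (hρ0 : 0 < ρ) (hρ1 : ρ ≤ 1) (hθ0 : 0 < θ) (hθ1 : θ < 1) (K : ℕ) :
    a K / 2 ≤ max (a K * (1 - a K)) (a K * (1 + ρ * θ ^ K) * (1 - a K * (1 + ρ * θ ^ K))) ∧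
      max (a K * (1 - a K)) (a K * (1 + ρ * θ ^ K) * (1 - a K * (1 + ρ * θ ^ K))) ≤ 2 * a K := by
  obtain ⟨⟨h0, _⟩, ⟨hq0, hq1⟩, _⟩ := toy_rates ha hρ0 hρ1 hθ0 hθ1 K
  obtain ⟨_, h1⟩ := ha K
  have hθK : θ ^ K ≤ 1 := pow_le_one₀ hθ0.le hθ1.le
  have hθK0 : 0 ≤ θ ^ K := pow_nonneg hθ0.le K
  constructor
  · exact le_max_of_le_left (by nlinarith)
  · refine max_le (by nlinarith) ?_
    have hq2 : a K * (1 + ρ * θ ^ K) ≤ 2 * a K := by nlinarith [mul_le_mul hρ1 hθK hθK0 zero_le_one]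
    nlinarith

/-- ★ **UPPER BOUND FOR THE TOY's CLOSED-FORM TERM**: `min(1, Δ_K∕max(1,σ_K)) ≤ √2·ρ·(√m·θ)^K` (`Δ_K = m^K a_K ρθ^K`, `σ_K² ≥ m^K a_K∕2`, `a_K² ≤ a_K`). [folklore] -/
theorem toyTerm_le (ha : ∀ K, 0 < a K ∧ a K ≤ 1 / 2) (hm : 1 ≤ m) (hρ0 : 0 < ρ) (hρ1 : ρ ≤ 1) (hθ0 : 0 < θ) (hθ1 : θ < 1) (K : ℕ) :
    min 1 (((m ^ K : ℕ) : ℝ) * |a K * (1 + ρ * θ ^ K) - a K| /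
        max 1 (Real.sqrt (((m ^ K : ℕ) : ℝ) * max (a K * (1 - a K)) (a K * (1 + ρ * θ ^ K) * (1 - a K * (1 + ρ * θ ^ K)))))) ≤
      Real.sqrt 2 * ρ * (Real.sqrt m * θ) ^ K := by
  obtain ⟨⟨h0, h1⟩, -, hdiff⟩ := toy_rates ha hρ0 hρ1 hθ0 hθ1 K
  obtain ⟨hvlo, -⟩ := toy_maxVar ha hρ0 hρ1 hθ0 hθ1 K
  set v := max (a K * (1 - a K)) (a K * (1 + ρ * θ ^ K) * (1 - a K * (1 + ρ * θ ^ K))) with hv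
  rw [Nat.cast_pow, hdiff, abs_of_nonneg (by positivity)]
  have hm0 : (0 : ℝ) ≤ m := Nat.cast_nonneg m
  set M := (m : ℝ) ^ K with hM
  have hM1 : 1 ≤ M := one_le_pow₀ (by exact_mod_cast hm)
  have hM0 : 0 < M := by linarith
  have hv0 : 0 < v := by linarith
  set σ := Real.sqrt (M * v) with hσ
  have hσ0 : 0 < σ := Real.sqrt_pos.2 (by positivity)
  have hσ2 : σ ^ 2 = M * v := Real.sq_sqrt (by positivity)
  set Δ := M * (a K * ρ * θ ^ K) with hΔ
  have hΔ0 : 0 ≤ Δ := by positivity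
  set R := Real.sqrt 2 * ρ * (Real.sqrt m * θ) ^ K with hR
  have hR0 : 0 ≤ R := by positivity
  have sqrt_pow_eq : Real.sqrt ((m : ℝ) ^ K) = Real.sqrt m ^ K := by
    rw [← Real.sqrt_sq (pow_nonneg (Real.sqrt_nonneg (m : ℝ)) K), ← pow_mul, mul_comm, pow_mul, Real.sq_sqrt hm0]
  have hRM : R = Real.sqrt 2 * ρ * (Real.sqrt M * θ ^ K) := by
    rw [hR, mul_pow, ← sqrt_pow_eq]
  have hR2 : R ^ 2 = 2 * ρ ^ 2 * (M * (θ ^ K) ^ 2) := by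
    rw [hRM, mul_pow, mul_pow, mul_pow, Real.sq_sqrt (by norm_num : (0:ℝ) ≤ 2), Real.sq_sqrt hM0.le]
  -- `min(1, Δ/max(1,σ)) ≤ Δ/σ ≤ R`
  have h1 : min 1 (Δ / max 1 σ) ≤ Δ / σ := (min_le_right _ _).trans (div_le_div_of_nonneg_left hΔ0 hσ0 (le_max_right _ _))
  have h2 : Δ / σ ≤ R := by
    rw [div_le_iff₀ hσ0]
    have h2v : (a K) ^ 2 ≤ 2 * v := by nlinarith
    have hsq : Δ ^ 2 ≤ (R * σ) ^ 2 := by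
      rw [show (R * σ) ^ 2 = R ^ 2 * σ ^ 2 by ring, hR2, hσ2]
      calc Δ ^ 2 = (a K) ^ 2 * (M ^ 2 * ρ ^ 2 * (θ ^ K) ^ 2) := by rw [hΔ]; ring
        _ ≤ (2 * v) * (M ^ 2 * ρ ^ 2 * (θ ^ K) ^ 2) := mul_le_mul_of_nonneg_right h2v (by positivity)
        _ = 2 * ρ ^ 2 * (M * (θ ^ K) ^ 2) * (M * v) := by ring
    exact (pow_le_pow_iff_left₀ hΔ0 (by positivity) two_ne_zero).1 hsq
  exact h1.trans h2

/-- ★ **LOWER BOUND FOR THE TOY's CLOSED-FORM TERM IN THE BULK**: once `σ_K ≥ 1`, `min(1, (ρ∕2)·√(a_K·(m·θ²)^K)) ≤ min(1, Δ_K∕max(1,σ_K))` (`σ_K² ≤ 2m^K a_K`). [folklore] -/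
theorem le_toyTerm (ha : ∀ K, 0 < a K ∧ a K ≤ 1 / 2) (hm : 1 ≤ m) (hρ0 : 0 < ρ) (hρ1 : ρ ≤ 1) (hθ0 : 0 < θ) (hθ1 : θ < 1) (K : ℕ)
    (hσ1 : 1 ≤ Real.sqrt (((m ^ K : ℕ) : ℝ) * max (a K * (1 - a K)) (a K * (1 + ρ * θ ^ K) * (1 - a K * (1 + ρ * θ ^ K))))) :
    min 1 (ρ / 2 * Real.sqrt (a K * ((m : ℝ) * θ ^ 2) ^ K)) ≤
      min 1 (((m ^ K : ℕ) : ℝ) * |a K * (1 + ρ * θ ^ K) - a K| /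
        max 1 (Real.sqrt (((m ^ K : ℕ) : ℝ) * max (a K * (1 - a K)) (a K * (1 + ρ * θ ^ K) * (1 - a K * (1 + ρ * θ ^ K)))))) := by
  obtain ⟨⟨h0, h1⟩, -, hdiff⟩ := toy_rates ha hρ0 hρ1 hθ0 hθ1 K
  obtain ⟨hvlo, hvhi⟩ := toy_maxVar ha hρ0 hρ1 hθ0 hθ1 K
  set v := max (a K * (1 - a K)) (a K * (1 + ρ * θ ^ K) * (1 - a K * (1 + ρ * θ ^ K))) with hv
  rw [Nat.cast_pow] at hσ1 ⊢
  rw [hdiff, abs_of_nonneg (by positivity), max_eq_right hσ1]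
  have hm0 : (0 : ℝ) ≤ m := Nat.cast_nonneg m
  set M := (m : ℝ) ^ K with hM
  have hM0 : 0 < M := pow_pos (by exact_mod_cast hm) K
  set σ := Real.sqrt (M * v) with hσ
  have hσ0 : 0 < σ := by linarith
  have hσ2 : σ ^ 2 = M * v := Real.sq_sqrt (by positivity)
  refine min_le_min_left _ ?_
  -- `(ρ/2)·√(a (mθ²)^K) ≤ Δ/σ`: square both sides
  rw [le_div_iff₀ hσ0]
  have hL0 : 0 ≤ ρ / 2 * Real.sqrt (a K * ((m : ℝ) * θ ^ 2) ^ K) * σ := by positivity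
  have hθθ : ((m : ℝ) * θ ^ 2) ^ K = M * (θ ^ K) ^ 2 := by rw [mul_pow, ← pow_mul, mul_comm 2 K, pow_mul, hM]
  have hva : v / 4 ≤ a K := by linarith
  have hsq : (ρ / 2 * Real.sqrt (a K * ((m : ℝ) * θ ^ 2) ^ K) * σ) ^ 2 ≤ (M * (a K * ρ * θ ^ K)) ^ 2 := by
    rw [mul_pow, mul_pow, Real.sq_sqrt (by positivity), hσ2, hθθ]
    calc (ρ / 2) ^ 2 * (a K * (M * (θ ^ K) ^ 2)) * (M * v) = (v / 4) * (a K * M ^ 2 * ρ ^ 2 * (θ ^ K) ^ 2) := by ring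
      _ ≤ a K * (a K * M ^ 2 * ρ ^ 2 * (θ ^ K) ^ 2) := mul_le_mul_of_nonneg_right hva (by positivity)
      _ = (M * (a K * ρ * θ ^ K)) ^ 2 := by ring
  exact (pow_le_pow_iff_left₀ hL0 (by positivity) two_ne_zero).1 hsq
end Toy

/-! ## §2 The dichotomy `√m·θ < 1` ∕ `> 1` for stub 2's dials on the toy caricature [folklore ∕ bookkeeping] -/

section Dichotomy
variable {a : ℕ → ℝ} {m : ℕ} {ρ θ : ℝ}
/-- ★★★ **CONTRACTION BEATS √(BLOCK GROWTH) ⇒ THE DIALS EXIST**: `n_K = m^K`, `p_K = a_K ∈ (0,½]`, `q_K = a_K(1 + ρθ^K)` with `m·θ² < 1` ⇒ SOME `(Bad, W, shA, shB, Wsh, δ)` give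
`HybridNE7` on the caricature carriers (FILE K's closed form is dominated by the geometric series `√2·ρ·(√m·θ)^K`). [folklore ∕ bookkeeping] -/
theorem exists_hybridNE7_toy_of_contraction (ha : ∀ K, 0 < a K ∧ a K ≤ 1 / 2) (hm : 1 ≤ m) (hρ0 : 0 < ρ) (hρ1 : ρ ≤ 1) (hθ0 : 0 < θ) (hθ1 : θ < 1)
    (hcontr : (m : ℝ) * θ ^ 2 < 1) {l₀ : ℝ} (hl₀ : 0 ≤ l₀) (vol : ℝ) :
    ∃ (Bad : ℕ → ℝ → Finset (Finset ℕ)) (W : ℕ → ℝ) (shA shB : ℕ → ℝ → Finset ℕ → ℝ) (Wsh δ : ℕ → ℝ),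
      HybridNE7 l₀ vol (fun K => (Finset.range (m ^ K)).powerset) (fun K _ S => a K ^ S.card * (1 - a K) ^ (m ^ K - S.card))
        (fun K _ S => (a K * (1 + ρ * θ ^ K)) ^ S.card * (1 - a K * (1 + ρ * θ ^ K)) ^ (m ^ K - S.card)) Bad W shA shB Wsh δ := by
  rw [exists_hybridNE7_caricature_iff_summable_closedForm (fun K => m ^ K) a (fun K => a K * (1 + ρ * θ ^ K))
    (fun K => (toy_rates ha hρ0 hρ1 hθ0 hθ1 K).1) (fun K => (toy_rates ha hρ0 hρ1 hθ0 hθ1 K).2.1) hl₀ vol]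
  have hs0 : 0 ≤ Real.sqrt m * θ := by positivity
  have hs1 : Real.sqrt m * θ < 1 := by
    have h : (Real.sqrt m * θ) ^ 2 < 1 := by rw [mul_pow, Real.sq_sqrt (Nat.cast_nonneg m)]; exact hcontr
    nlinarith
  refine Summable.of_nonneg_of_le (fun K => le_min zero_le_one (by positivity)) (fun K => toyTerm_le ha hm hρ0 hρ1 hθ0 hθ1 K) ?_
  exact (summable_geometric_of_lt_one hs0 hs1).mul_left _

/-- ★★★ **√(BLOCK GROWTH) BEATS CONTRACTION ⇒ NO DIALS** (law separation): same toy with `1 < m·θ²` and a SUB-EXPONENTIAL activity (`s^K·a_K → ∞` for every `s > 1` — Bałaban's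
poly-log activity is such, §3) ⇒ NO `(Bad, W, shA, shB, Wsh, δ)` gives `HybridNE7` on the caricature carriers: the closed-form term is eventually `1`. [folklore ∕ bookkeeping] -/
theorem not_exists_hybridNE7_toy_of_expansion (ha : ∀ K, 0 < a K ∧ a K ≤ 1 / 2) (hm : 1 ≤ m) (hρ0 : 0 < ρ) (hρ1 : ρ ≤ 1) (hθ0 : 0 < θ) (hθ1 : θ < 1)
    (hexp : 1 < (m : ℝ) * θ ^ 2) (hsub : ∀ s : ℝ, 1 < s → Tendsto (fun K => s ^ K * a K) atTop atTop) {l₀ : ℝ} (hl₀ : 0 ≤ l₀) (vol : ℝ) :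
    ¬ ∃ (Bad : ℕ → ℝ → Finset (Finset ℕ)) (W : ℕ → ℝ) (shA shB : ℕ → ℝ → Finset ℕ → ℝ) (Wsh δ : ℕ → ℝ),
      HybridNE7 l₀ vol (fun K => (Finset.range (m ^ K)).powerset) (fun K _ S => a K ^ S.card * (1 - a K) ^ (m ^ K - S.card))
        (fun K _ S => (a K * (1 + ρ * θ ^ K)) ^ S.card * (1 - a K * (1 + ρ * θ ^ K)) ^ (m ^ K - S.card)) Bad W shA shB Wsh δ := by
  rw [exists_hybridNE7_caricature_iff_summable_closedForm (fun K => m ^ K) a (fun K => a K * (1 + ρ * θ ^ K))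
    (fun K => (toy_rates ha hρ0 hρ1 hθ0 hθ1 K).1) (fun K => (toy_rates ha hρ0 hρ1 hθ0 hθ1 K).2.1) hl₀ vol]
  apply not_summable_of_eventually_eq_one
  -- `m > 1` (from `mθ² > 1`, `θ < 1`), so `m^K a_K → ∞` and `σ_K ≥ 1` eventually; and `(mθ²)^K a_K → ∞`
  have hθ2 : θ ^ 2 < 1 := by nlinarith
  have hm1 : (1 : ℝ) < m := by
    by_contra h
    have h' : (m : ℝ) ≤ 1 := not_lt.1 h
    nlinarith [pow_nonneg hθ0.le 2]
  have hA := hsub (m : ℝ) hm1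
  have hB := hsub ((m : ℝ) * θ ^ 2) hexp
  have hev1 : ∀ᶠ K in atTop, (2 : ℝ) ≤ (m : ℝ) ^ K * a K := hA.eventually_ge_atTop 2
  have hev2 : ∀ᶠ K in atTop, (2 / ρ) ^ 2 ≤ ((m : ℝ) * θ ^ 2) ^ K * a K := hB.eventually_ge_atTop _
  filter_upwards [hev1, hev2] with K h1 h2
  obtain ⟨hvlo, -⟩ := toy_maxVar ha hρ0 hρ1 hθ0 hθ1 K
  have ha0 := (ha K).1
  -- `σ_K ≥ 1`
  have hσ1 : 1 ≤ Real.sqrt (((m ^ K : ℕ) : ℝ) * max (a K * (1 - a K)) (a K * (1 + ρ * θ ^ K) * (1 - a K * (1 + ρ * θ ^ K)))) := by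
    rw [Nat.cast_pow]
    refine Real.one_le_sqrt.2 ?_
    nlinarith [mul_le_mul_of_nonneg_left hvlo (pow_nonneg (Nat.cast_nonneg m) K)]
  have hlow := le_toyTerm ha hm hρ0 hρ1 hθ0 hθ1 K hσ1
  -- the lower term is `1`
  have hbig : 1 ≤ ρ / 2 * Real.sqrt (a K * ((m : ℝ) * θ ^ 2) ^ K) := by
    have h3 : 2 / ρ ≤ Real.sqrt (a K * ((m : ℝ) * θ ^ 2) ^ K) := by
      rw [show a K * ((m : ℝ) * θ ^ 2) ^ K = ((m : ℝ) * θ ^ 2) ^ K * a K by ring]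
      exact (Real.le_sqrt' (by positivity)).2 h2
    calc (1 : ℝ) = ρ / 2 * (2 / ρ) := by field_simp
      _ ≤ ρ / 2 * Real.sqrt (a K * ((m : ℝ) * θ ^ 2) ^ K) := mul_le_mul_of_nonneg_left h3 (by positivity)
  rw [min_eq_left hbig] at hlow
  exact le_antisymm (min_le_left _ _) hlow

/-- ★★★★ **THE TOY's SHARP THRESHOLD** [folklore ∕ bookkeeping]: `n_K = m^K` independent level-1 blocks, run A's per-block large-field probability a sub-exponential `a_K ∈ (0,½]`, run B's
`a_K(1 + ρθ^K)` (a RELATIVE two-run discrepancy decaying geometrically at rate `θ`); then for `m·θ² ≠ 1`: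
(SOME dials give `HybridNE7` on the caricature carriers) ⟺ `m·θ² < 1` — the relative discrepancy must contract faster than the inverse SQUARE ROOT of the block-number growth. -/
theorem exists_hybridNE7_toy_iff (ha : ∀ K, 0 < a K ∧ a K ≤ 1 / 2) (hm : 1 ≤ m) (hρ0 : 0 < ρ) (hρ1 : ρ ≤ 1) (hθ0 : 0 < θ) (hθ1 : θ < 1)
    (hne : (m : ℝ) * θ ^ 2 ≠ 1) (hsub : ∀ s : ℝ, 1 < s → Tendsto (fun K => s ^ K * a K) atTop atTop) {l₀ : ℝ} (hl₀ : 0 ≤ l₀) (vol : ℝ) :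
    (∃ (Bad : ℕ → ℝ → Finset (Finset ℕ)) (W : ℕ → ℝ) (shA shB : ℕ → ℝ → Finset ℕ → ℝ) (Wsh δ : ℕ → ℝ),
      HybridNE7 l₀ vol (fun K => (Finset.range (m ^ K)).powerset) (fun K _ S => a K ^ S.card * (1 - a K) ^ (m ^ K - S.card))
        (fun K _ S => (a K * (1 + ρ * θ ^ K)) ^ S.card * (1 - a K * (1 + ρ * θ ^ K)) ^ (m ^ K - S.card)) Bad W shA shB Wsh δ) ↔
    (m : ℝ) * θ ^ 2 < 1 := by
  rcases lt_or_gt_of_ne hne with h | h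
  · exact ⟨fun _ => h, fun _ => exists_hybridNE7_toy_of_contraction ha hm hρ0 hρ1 hθ0 hθ1 h hl₀ vol⟩
  · exact ⟨fun hex => absurd hex (not_exists_hybridNE7_toy_of_expansion ha hm hρ0 hρ1 hθ0 hθ1 h hsub hl₀ vol), fun h' => absurd h' (not_lt.2 h.le)⟩
end Dichotomy

/-! ## §3 Bałaban's poly-log activity is sub-exponential (dag-n19-w1's `NotGeometric` BY NAME), so the threshold applies to it [folklore] -/

section Activity
variable {A x₀ b : ℝ} {p₀ : ℕ}
/-- Bałaban's activity `a_K = exp(−(A·log(x₀ + bK))^{2p₀})` is SUB-EXPONENTIAL: `s^K·a_K → ∞` for every `s > 1` (`eventually_lt_balabanActivity` at `θ = s⁻¹`). [folklore] -/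
theorem tendsto_pow_mul_balabanActivity (hA : 0 < A) (hx₀ : 1 < x₀) (hb : 0 < b) (p₀ : ℕ) {s : ℝ} (hs : 1 < s) :
    Tendsto (fun K : ℕ => s ^ K * Real.exp (-((A * Real.log (x₀ + b * K)) ^ (2 * p₀)))) atTop atTop := by
  have hs0 : 0 < s := by linarith
  have hθ : (0 : ℝ) < s⁻¹ := inv_pos.2 hs0
  have hθ1 : s⁻¹ < 1 := inv_lt_one_of_one_lt₀ hs
  refine tendsto_atTop_atTop.2 fun M => ?_
  obtain ⟨N, hN⟩ := eventually_lt_balabanActivity hA hx₀ hb p₀ hθ hθ1 M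
  refine ⟨N, fun K hK => ?_⟩
  have h := hN K hK
  have hsK : (0 : ℝ) < s ^ K := pow_pos hs0 K
  rw [inv_pow, ← div_eq_mul_inv, div_lt_iff₀ hsK] at h
  linarith [mul_comm (Real.exp (-((A * Real.log (x₀ + b * K)) ^ (2 * p₀)))) (s ^ K)]

/-- Bałaban's activity lies in `(0, ½]` as soon as `log 2 ≤ (A·log x₀)^{2p₀}` (`x₀ > 1`, `A, b > 0`; the exponent only grows with `K`). [folklore] -/
theorem balabanActivity_mem (hA : 0 < A) (hx₀ : 1 < x₀) (hb : 0 < b) (p₀ : ℕ) (hx : Real.log 2 ≤ (A * Real.log x₀) ^ (2 * p₀)) (K : ℕ) :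
    0 < Real.exp (-((A * Real.log (x₀ + b * K)) ^ (2 * p₀))) ∧ Real.exp (-((A * Real.log (x₀ + b * K)) ^ (2 * p₀))) ≤ 1 / 2 := by
  refine ⟨Real.exp_pos _, ?_⟩
  have hK : (0 : ℝ) ≤ b * K := by positivity
  have hlog : A * Real.log x₀ ≤ A * Real.log (x₀ + b * K) :=
    mul_le_mul_of_nonneg_left (Real.log_le_log (by linarith) (by linarith)) hA.le
  have hlog0 : 0 ≤ A * Real.log x₀ := mul_nonneg hA.le (Real.log_nonneg hx₀.le)
  have hpow : (A * Real.log x₀) ^ (2 * p₀) ≤ (A * Real.log (x₀ + b * K)) ^ (2 * p₀) := pow_le_pow_left₀ hlog0 hlog _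
  rw [show (1 : ℝ) / 2 = Real.exp (-Real.log 2) by rw [Real.exp_neg, Real.exp_log two_pos]; norm_num, Real.exp_le_exp]
  linarith

/-- ★★★★ **THE THRESHOLD FOR BAŁABAN's ACTIVITY** [folklore ∕ bookkeeping]: `n_K = m^K` blocks with run A's rate `a_K = exp(−(A·log(x₀+bK))^{2p₀})` ([Balaban1988Convergent] (1.1)'s age
activity, as in dag-n19-w1's p603780 ∕ MY p605682) and run B's `a_K(1 + ρθ^K)`: for `m·θ² ≠ 1`, SOME dials give `HybridNE7` on the caricature ⟺ `m·θ² < 1`. With `m = L⁴` new blocks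
per step this reads `θ < L^{−2}`: a two-run RELATIVE discrepancy of the level-1 large-field probability that is first order in a per-step contraction `θ ≥ L^{−2}` KILLS stub 2's
face triple on the caricature; second order (`θ²`-type, i.e. `θ < L^{−2}`) passes. -/
theorem exists_hybridNE7_balabanActivity_iff (hA : 0 < A) (hx₀ : 1 < x₀) (hb : 0 < b) (p₀ : ℕ) (hx : Real.log 2 ≤ (A * Real.log x₀) ^ (2 * p₀))
    {m : ℕ} (hm : 1 ≤ m) {ρ θ : ℝ} (hρ0 : 0 < ρ) (hρ1 : ρ ≤ 1) (hθ0 : 0 < θ) (hθ1 : θ < 1) (hne : (m : ℝ) * θ ^ 2 ≠ 1) {l₀ : ℝ} (hl₀ : 0 ≤ l₀) (vol : ℝ) :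
    (∃ (Bad : ℕ → ℝ → Finset (Finset ℕ)) (W : ℕ → ℝ) (shA shB : ℕ → ℝ → Finset ℕ → ℝ) (Wsh δ : ℕ → ℝ),
      HybridNE7 l₀ vol (fun K => (Finset.range (m ^ K)).powerset)
        (fun K _ S => Real.exp (-((A * Real.log (x₀ + b * K)) ^ (2 * p₀))) ^ S.card * (1 - Real.exp (-((A * Real.log (x₀ + b * K)) ^ (2 * p₀)))) ^ (m ^ K - S.card))
        (fun K _ S => (Real.exp (-((A * Real.log (x₀ + b * K)) ^ (2 * p₀))) * (1 + ρ * θ ^ K)) ^ S.card *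
          (1 - Real.exp (-((A * Real.log (x₀ + b * K)) ^ (2 * p₀))) * (1 + ρ * θ ^ K)) ^ (m ^ K - S.card)) Bad W shA shB Wsh δ) ↔
    (m : ℝ) * θ ^ 2 < 1 :=
  exists_hybridNE7_toy_iff (a := fun K => Real.exp (-((A * Real.log (x₀ + b * K)) ^ (2 * p₀)))) (balabanActivity_mem hA hx₀ hb p₀ hx) hm hρ0 hρ1 hθ0 hθ1 hne
    (fun _ hs => tendsto_pow_mul_balabanActivity hA hx₀ hb p₀ hs) hl₀ vol

/-- (A6) The hypotheses of `exists_hybridNE7_balabanActivity_iff` are JOINTLY INHABITED on both sides of the threshold: `A = b = 1`, `x₀ = 3`, `p₀ = 1` (`log 2 ≤ (log 3)²`), `m = 4`,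
`ρ = 1`, and `θ = ⅓` (`mθ² = 4∕9 < 1`: dials) resp. `θ = ¾` (`mθ² = 9∕4 > 1`: no dials). [folklore] -/
theorem toy_hypotheses_inhabited :
    (0 : ℝ) < 1 ∧ (1 : ℝ) < 3 ∧ Real.log 2 ≤ (1 * Real.log 3) ^ (2 * 1) ∧ (1 : ℕ) ≤ 4 ∧ (0 : ℝ) < 1 ∧ (1 : ℝ) ≤ 1 ∧
      ((0 : ℝ) < 1 / 3 ∧ (1 : ℝ) / 3 < 1 ∧ ((4 : ℕ) : ℝ) * (1 / 3) ^ 2 < 1) ∧ ((0 : ℝ) < 3 / 4 ∧ (3 : ℝ) / 4 < 1 ∧ 1 < ((4 : ℕ) : ℝ) * (3 / 4) ^ 2) := by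
  have hlog3 : 1 < Real.log 3 := by
    rw [Real.lt_log_iff_exp_lt (by norm_num)]
    have := Real.exp_one_lt_d9; linarith
  have hlog2 : Real.log 2 < 1 := by have := Real.log_two_lt_d9; linarith
  refine ⟨one_pos, by norm_num, ?_, by norm_num, one_pos, le_rfl, ⟨by norm_num, by norm_num, by norm_num⟩, ⟨by norm_num, by norm_num, by norm_num⟩⟩
  rw [one_mul, mul_one]
  nlinarith
end Activity


/-! ## §4 The general reading behind the toy: in the bulk, the closed-form term IS «√(expected large-field block number) × relative discrepancy» [folklore] -/

section RelPrecision
variable {p q : ℝ} {n : ℕ}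
/-- ★★ **RELATIVE-PRECISION FORM OF THE BULK TERM** [folklore]: for comparable rates `0 < p ≤ q ≤ 2p ≤ 1` in the bulk (`σ ≥ 1`), the closed-form term `min(1, Δ∕σ)` is, within a factor `√2`
either way, `min(1, √(n·p)·(q∕p − 1))` — the expected number `n·p` of large-field blocks enters through its SQUARE ROOT, the two-run discrepancy through its RELATIVE size `q∕p − 1`:
`min(1, √(np)·(q∕p−1)∕√2) ≤ min(1, Δ∕σ) ≤ min(1, √2·√(np)·(q∕p−1))`. -/
theorem bulkTerm_relPrecision (hp0 : 0 < p) (hpq : p ≤ q) (hq2 : q ≤ 2 * p) (hp1 : 2 * p ≤ 1)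
    (hσ1 : 1 ≤ Real.sqrt (n * max (p * (1 - p)) (q * (1 - q)))) :
    min 1 (Real.sqrt (n * p) * (q / p - 1) / Real.sqrt 2) ≤ min 1 (n * |q - p| / max 1 (Real.sqrt (n * max (p * (1 - p)) (q * (1 - q))))) ∧
      min 1 (n * |q - p| / max 1 (Real.sqrt (n * max (p * (1 - p)) (q * (1 - q))))) ≤ min 1 (Real.sqrt 2 * (Real.sqrt (n * p) * (q / p - 1))) := by
  set v := max (p * (1 - p)) (q * (1 - q)) with hv
  have hvlo : p / 2 ≤ v := le_max_of_le_left (by nlinarith)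
  have hvhi : v ≤ 2 * p := max_le (by nlinarith) (by nlinarith)
  have hn0 : (0 : ℝ) ≤ n := Nat.cast_nonneg n
  set σ := Real.sqrt (n * v) with hσ
  have hσ0 : 0 < σ := by linarith
  have hσ2 : σ ^ 2 = n * v := Real.sq_sqrt (by nlinarith)
  rw [max_eq_right hσ1, abs_of_nonneg (by linarith)]
  have hrel : Real.sqrt (n * p) * (q / p - 1) = Real.sqrt (n * p) / p * (q - p) := by field_simp
  have hsp0 : 0 ≤ Real.sqrt (n * p) := Real.sqrt_nonneg _
  have hsp2 : Real.sqrt (n * p) ^ 2 = n * p := Real.sq_sqrt (by positivity)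
  have hqp : 0 ≤ q - p := by linarith
  constructor
  · refine min_le_min_left _ ?_
    -- `√(np)(q−p)/(p√2) ≤ n(q−p)/σ`  ⟸  `σ·√(np) ≤ √2·n·p`  ⟸  squares: `n v · n p ≤ 2 n² p²` ⟸ `v ≤ 2p`
    rw [hrel, div_le_div_iff₀ (by positivity) hσ0]
    have key : Real.sqrt (n * p) * σ ≤ Real.sqrt 2 * (n * p) := by
      have h2 : (Real.sqrt (n * p) * σ) ^ 2 ≤ (Real.sqrt 2 * (n * p)) ^ 2 := by
        rw [show (Real.sqrt (n * p) * σ) ^ 2 = Real.sqrt (n * p) ^ 2 * σ ^ 2 by ring,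
          show (Real.sqrt 2 * (n * p)) ^ 2 = Real.sqrt 2 ^ 2 * (n * p) ^ 2 by ring, hsp2, hσ2, Real.sq_sqrt (by norm_num : (0:ℝ) ≤ 2)]
        have : (n : ℝ) * v ≤ n * (2 * p) := mul_le_mul_of_nonneg_left hvhi hn0
        nlinarith
      exact (pow_le_pow_iff_left₀ (by positivity) (by positivity) two_ne_zero).1 h2
    calc Real.sqrt (n * p) / p * (q - p) * σ = (Real.sqrt (n * p) * σ) * (q - p) / p := by field_simp
      _ ≤ (Real.sqrt 2 * (n * p)) * (q - p) / p := by gcongr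
      _ = n * (q - p) * Real.sqrt 2 := by field_simp
  · refine min_le_min_left _ ?_
    -- `n(q−p)/σ ≤ √2·√(np)(q−p)/p`  ⟸  `n p ≤ √2 √(np) σ` ⟸ squares: `n² p² ≤ 2 n p · n v` ⟸ `p ≤ 2v`
    rw [hrel, div_le_iff₀ hσ0]
    have key : (n : ℝ) * p ≤ Real.sqrt 2 * Real.sqrt (n * p) * σ := by
      have h2 : ((n : ℝ) * p) ^ 2 ≤ (Real.sqrt 2 * Real.sqrt (n * p) * σ) ^ 2 := by
        rw [show (Real.sqrt 2 * Real.sqrt (n * p) * σ) ^ 2 = Real.sqrt 2 ^ 2 * Real.sqrt (n * p) ^ 2 * σ ^ 2 by ring, hsp2, hσ2,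
          Real.sq_sqrt (by norm_num : (0:ℝ) ≤ 2)]
        have : (n : ℝ) * p ≤ n * (2 * v) := mul_le_mul_of_nonneg_left (by linarith) hn0
        nlinarith
      exact (pow_le_pow_iff_left₀ (by positivity) (by positivity) two_ne_zero).1 h2
    calc (n : ℝ) * (q - p) = (n * p) * (q - p) / p := by field_simp
      _ ≤ (Real.sqrt 2 * Real.sqrt (n * p) * σ) * (q - p) / p := by gcongr
      _ = Real.sqrt 2 * (Real.sqrt (n * p) / p * (q - p)) * σ := by field_simp
end RelPrecision

/-! ## §5 Along `K`: with comparable rates in the bulk, stub 2's dials exist ⟺ `Σ_K min(1, √(n_K p_K)·ε_K) < ∞`, `ε_K = q_K∕p_K − 1` the RELATIVE discrepancy [folklore ∕ bookkeeping] -/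

section RelPrecisionAlongK
variable (n : ℕ → ℕ) (p ε : ℕ → ℝ)
/-- ★★★ **THE RELATIVE-PRECISION CRITERION** [folklore ∕ bookkeeping]: rates `p_K ∈ (0, ½]`, `q_K = p_K(1 + ε_K)` with `0 ≤ ε_K ≤ 1`, bulk at every step
(`1 ≤ n_K·max(p_K(1−p_K), q_K(1−q_K))`); then SOME `(Bad, W, shA, shB, Wsh, δ)` give `HybridNE7` on the caricature carriers ⟺ `Σ_K min(1, √(n_K p_K)·ε_K) < ∞` — the two runs'
per-block large-field probabilities must agree to relative precision `o((n_K p_K)^{−1∕2})`, summably (FILE K's closed form ∘ `bulkTerm_relPrecision`). -/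
theorem exists_hybridNE7_caricature_iff_summable_relPrecision_of_bulk (hp : ∀ K, 0 < p K ∧ p K ≤ 1 / 2) (hε : ∀ K, 0 ≤ ε K ∧ ε K ≤ 1)
    (hbulk : ∀ K, 1 ≤ (n K : ℝ) * max (p K * (1 - p K)) (p K * (1 + ε K) * (1 - p K * (1 + ε K)))) {l₀ : ℝ} (hl₀ : 0 ≤ l₀) (vol : ℝ) :
    (∃ (Bad : ℕ → ℝ → Finset (Finset ℕ)) (W : ℕ → ℝ) (shA shB : ℕ → ℝ → Finset ℕ → ℝ) (Wsh δ : ℕ → ℝ),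
      HybridNE7 l₀ vol (fun K => (Finset.range (n K)).powerset) (fun K _ S => p K ^ S.card * (1 - p K) ^ (n K - S.card))
        (fun K _ S => (p K * (1 + ε K)) ^ S.card * (1 - p K * (1 + ε K)) ^ (n K - S.card)) Bad W shA shB Wsh δ) ↔
    Summable fun K => min 1 (Real.sqrt (n K * p K) * ε K) := by
  have hq : ∀ K, 0 ≤ p K * (1 + ε K) ∧ p K * (1 + ε K) ≤ 1 := fun K => by
    obtain ⟨h0, h1⟩ := hp K; obtain ⟨e0, e1⟩ := hε K
    exact ⟨by positivity, by nlinarith⟩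
  rw [exists_hybridNE7_caricature_iff_summable_closedForm n p (fun K => p K * (1 + ε K)) (fun K => ⟨(hp K).1, by linarith [(hp K).2]⟩) hq hl₀ vol]
  have hrel : ∀ K, p K * (1 + ε K) / p K - 1 = ε K := fun K => by have := (hp K).1.ne'; field_simp; ring
  have hord := fun K => bulkTerm_relPrecision (n := n K) (hp K).1 (by nlinarith [(hp K).1, (hε K).1] : p K ≤ p K * (1 + ε K))
    (by nlinarith [(hp K).1, (hε K).2] : p K * (1 + ε K) ≤ 2 * p K) (by linarith [(hp K).2]) (Real.one_le_sqrt.2 (hbulk K))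
  simp_rw [hrel] at hord
  have h2 : (1 : ℝ) ≤ Real.sqrt 2 := Real.one_le_sqrt.2 (by norm_num)
  have h2' : 0 < Real.sqrt 2 := by positivity
  refine summable_iff_of_order (c := 1 / Real.sqrt 2) (C := Real.sqrt 2) (by positivity) (fun K => le_min zero_le_one (by positivity))
    (fun K => le_min zero_le_one (mul_nonneg (Real.sqrt_nonneg _) (hε K).1)) (fun K => ?_) (fun K => ?_)
  · -- lower: `(1/√2)·min(1, √(np)ε) ≤ min(1, √(np)ε/√2) ≤ closed-form term`
    have hc1 : 1 / Real.sqrt 2 ≤ 1 := by rw [div_le_one h2']; exact h2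
    have hc0 : 0 ≤ 1 / Real.sqrt 2 := by positivity
    calc 1 / Real.sqrt 2 * min 1 (Real.sqrt (n K * p K) * ε K) ≤ min 1 (1 / Real.sqrt 2 * (Real.sqrt (n K * p K) * ε K)) :=
          le_min (by nlinarith [min_le_left (1 : ℝ) (Real.sqrt (n K * p K) * ε K)]) (mul_le_mul_of_nonneg_left (min_le_right _ _) hc0)
      _ = min 1 (Real.sqrt (n K * p K) * ε K / Real.sqrt 2) := by rw [div_mul_eq_mul_div, one_mul]
      _ ≤ _ := (hord K).1
  · -- upper: closed-form term `≤ min(1, √2·√(np)ε) ≤ √2·min(1, √(np)ε)`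
    refine (hord K).2.trans ?_
    rcases le_total 1 (Real.sqrt (n K * p K) * ε K) with h | h
    · rw [min_eq_left h]; exact (min_le_left _ _).trans (by nlinarith)
    · rw [min_eq_right h]; exact min_le_right _ _
end RelPrecisionAlongK
end Summit.QuantumFields.YangMills.BalabanUVNodes.N20BlockCaricatureDiscrepancyToy

end
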